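import Summits.Ventures.LatticeQCDFlow.Scoring.TorusAreaLaw2DHasAreaLaw
import Literature.MathematicalPhysics.QuantumFieldTheory.LatticeGaugeProofs
import Literature.MathematicalPhysics.QuantumLattice.WilsonLoopsProofs
import HarnessLib

/-!
# The exact non-abelian area law in two dimensions, V-e: EVERY NON-TRIVIAL IRREDUCIBLE REPRESENTATION OF EVERY COMPACT GROUP SATISFIES `HasAreaLaw 2 ρ β` AT EVERY COUPLING

HONEST FRAMING: exact (Metropolis-corrected) sampling algorithms for lattice gauge theory;
figures of merit are autocorrelation/cost numbers at stated couplings and volumes; no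
continuum-physics claim.

Venture `LatticeQCDFlow` (cell pub-lqcd), sub-topic `Scoring`; FANOUT row 5 (`s0-sun-a`), GEN-18.
NEW WORK of the cell (placement rule).  Part V-d (`TorusAreaLaw2DHasAreaLaw`) proves the volume-uniform area law
`HasAreaLaw 2 ρ β` (Literature `ConstructiveQFTWave0`, S12) for every continuous representation `ρ : G → M_N(ℂ)`
of a compact second-countable group with trivial commutant (`IsIrreducibleFamily ρ`) PROVIDED some `ρ(g₀)` has
`‖tr ρ(g₀)‖ < N`.  This file removes the proviso:

* `eq_smul_one_of_norm_trace_eq_card` — a unitary `N × N` matrix `U` with `‖tr U‖ = N` is the scalar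
  `(tr U / N)·1` (`‖N·U − tr U·1‖_F² = N³ − N|tr U|² = 0`);
* `exists_norm_trace_lt_of_isIrreducibleFamily` — for `N ≥ 2` and trivial commutant some `‖tr ρ(g₀)‖ < N`
  (otherwise every `ρ(g)` — unitary up to the unitarian trick — is a scalar, and the elementary matrix `E₀₁`
  would commute with `ρ`);
* `hasAreaLaw_two_of_card_eq_one` — a non-trivial continuous ONE-dimensional representation (a character
  `χ ≠ 1`; `|χ| = 1` automatically) satisfies `HasAreaLaw 2 ρ β`: its one-plaquette scalar `∫ χ w` is the real
  number `∫ Re χ · w` (inversion symmetry), strictly shorter than `∫ w` because `Re χ(g₀) < 1`;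
* `isIrreducibleFamily_of_isIrreducible` — Schur's lemma in matrix form: Mathlib's `Representation.IsIrreducible`
  for `v ↦ ρ(g) v` on `ℂ^N` implies the trivial-commutant property `IsIrreducibleFamily ρ`
  (`hasAreaLaw_two_of_isIrreducible` is the headline with that hypothesis);
* `not_hasAreaLaw_of_forall_eq_one` — the trivial representation has `⟨W⟩ = 1`, hence NO area law in any
  dimension `d ≥ 2`; so for representations with trivial commutant `HasAreaLaw 2 ρ β ↔ ρ ≠ 1`
  (`hasAreaLaw_two_iff_of_irreducible`);
* `not_hasAreaLaw_two_specialUnitary_one`, **`hasAreaLaw_two_specialUnitary_iff`** — `SU(N)`: `HasAreaLaw 2 ↔ N ≥ 2`;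
* **`hasAreaLaw_two_of_irreducible`** — EVERY continuous representation of EVERY compact second-countable group
  with trivial commutant (every irreducible one, by Schur's lemma) which is not the trivial representation
  satisfies `HasAreaLaw 2 ρ β` for EVERY real `β`.  (The trivial representation has `⟨W⟩ = 1`.)

Infinite volume: `hasAreaLawState_of_irreducible_two`, `hasAreaLawState_unitary_two`,
`hasAreaLawState_specialUnitary_two` — every infinite-volume limit point (`infiniteVolumeLimitPoints ρ β`) obeys
the area law in the state form `HasAreaLawState` of `Literature…WilsonLoops` (via the tree's
`hasAreaLawState_of_hasAreaLaw_holds`).  No `def`, nothing cited as a fact, 0 sorry.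
-/

noncomputable section

open MeasureTheory Function Finset
open scoped ComplexOrder Matrix
open Literature.MathematicalPhysics.QuantumFieldTheory
open Literature.MathematicalPhysics.QuantumLattice
open Literature.RepresentationTheory.CompactGroups
open Summit.Ventures.LatticeQCDFlow.Theory2.Lattice
open Summit.Ventures.LatticeQCDFlow.Theory2.Lattice.TwoDim

namespace Summit.Ventures.LatticeQCDFlow.Scoring

/-! ## A unitary matrix with maximal trace modulus is a scalar -/

section Matrix

variable {N : ℕ}

/-- A unitary `N × N` matrix whose trace has the maximal modulus `N` is the scalar `(tr U / N)·1`: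
`tr((N U − tr U·1)ᴴ (N U − tr U·1)) = N³ − N |tr U|² = 0`. -/
theorem eq_smul_one_of_norm_trace_eq_card {U : Matrix (Fin N) (Fin N) ℂ}
    (hU : U ∈ Matrix.unitaryGroup (Fin N) ℂ) (htr : ‖U.trace‖ = N) :
    U = ((N : ℂ)⁻¹ * U.trace) • (1 : Matrix (Fin N) (Fin N) ℂ) := by
  rcases Nat.eq_zero_or_pos N with hN | hN
  · subst hN
    ext i j
    exact Fin.elim0 i
  have hNc : (N : ℂ) ≠ 0 := Nat.cast_ne_zero.mpr hN.ne'
  have hUU : Uᴴ * U = 1 := by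
    have h := Matrix.mem_unitaryGroup_iff'.mp hU
    rwa [Matrix.star_eq_conjTranspose] at h
  have htt : U.trace * (starRingEnd ℂ) U.trace = (N : ℂ) ^ 2 := by
    rw [Complex.mul_conj, Complex.normSq_eq_norm_sq, htr]
    push_cast
    ring
  have key : (((N : ℂ) • U - U.trace • (1 : Matrix (Fin N) (Fin N) ℂ))ᴴ *
      ((N : ℂ) • U - U.trace • (1 : Matrix (Fin N) (Fin N) ℂ))).trace = 0 := by
    simp only [Matrix.conjTranspose_sub, Matrix.conjTranspose_smul, Matrix.conjTranspose_one, Matrix.sub_mul,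
      Matrix.mul_sub, Matrix.smul_mul, Matrix.mul_smul, Matrix.one_mul, Matrix.mul_one, hUU, Matrix.trace_sub,
      Matrix.trace_smul, Matrix.trace_one, Matrix.trace_conjTranspose, smul_eq_mul, Fintype.card_fin,
      Complex.star_def, map_natCast]
    linear_combination (-(N : ℂ)) * htt
  have hzero : (N : ℂ) • U - U.trace • (1 : Matrix (Fin N) (Fin N) ℂ) = 0 :=
    Matrix.trace_conjTranspose_mul_self_eq_zero_iff.mp key
  rw [sub_eq_zero] at hzero
  calc U = (N : ℂ)⁻¹ • ((N : ℂ) • U) := by rw [smul_smul, inv_mul_cancel₀ hNc, one_smul]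
    _ = ((N : ℂ)⁻¹ * U.trace) • (1 : Matrix (Fin N) (Fin N) ℂ) := by rw [hzero, smul_smul]

end Matrix

section General

variable {G : Type*} [Group G] [TopologicalSpace G] [IsTopologicalGroup G]
  [CompactSpace G] [SecondCountableTopology G] [MeasurableSpace G] [BorelSpace G] {N : ℕ}
  (ρ : G →* Matrix (Fin N) (Fin N) ℂ)

omit [SecondCountableTopology G] [MeasurableSpace G] [BorelSpace G] in
/-- For `N ≥ 2`, a continuous representation with trivial commutant takes SOME value with `‖tr ρ(g₀)‖ < N`:
otherwise every `ρ(g)` (a conjugate of a unitary matrix of maximal trace modulus) is a scalar, and the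
elementary matrix `E₀₁` — not a scalar — commutes with all of them. -/
theorem exists_norm_trace_lt_of_isIrreducibleFamily (hN : 2 ≤ N) (hρ : Continuous ρ)
    (hirr : IsIrreducibleFamily fun g : G => ρ g) : ∃ g₀ : G, ‖(ρ g₀).trace‖ < N := by
  by_contra h
  push Not at h
  -- every `ρ g` is a scalar
  have hscal : ∀ g : G, ∃ s : ℂ, ρ g = s • (1 : Matrix (Fin N) (Fin N) ℂ) := fun g => by
    have hn : ‖(CompactGroup.unitarize ρ hρ g).trace‖ = N := by
      rw [CompactGroup.trace_unitarize]
      exact le_antisymm (norm_trace_le_card ρ hρ g) (h g)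
    obtain ⟨s, hs⟩ : ∃ s : ℂ, CompactGroup.unitarize ρ hρ g = s • (1 : Matrix (Fin N) (Fin N) ℂ) :=
      ⟨_, eq_smul_one_of_norm_trace_eq_card (CompactGroup.unitarize_mem_unitaryGroup ρ hρ g) hn⟩
    rw [CompactGroup.unitarize_apply] at hs
    have hP := CompactGroup.isUnit_det_unitarizer ρ hρ
    refine ⟨s, ?_⟩
    calc ρ g = (CompactGroup.unitarizer ρ hρ)⁻¹ *
          (CompactGroup.unitarizer ρ hρ * ρ g * (CompactGroup.unitarizer ρ hρ)⁻¹) *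
            CompactGroup.unitarizer ρ hρ := by
          rw [Matrix.mul_assoc, Matrix.mul_assoc, Matrix.nonsing_inv_mul _ hP, Matrix.mul_one,
            ← Matrix.mul_assoc, Matrix.nonsing_inv_mul _ hP, Matrix.one_mul]
      _ = s • (1 : Matrix (Fin N) (Fin N) ℂ) := by
          rw [hs, Matrix.mul_smul, Matrix.mul_one, Matrix.smul_mul, Matrix.nonsing_inv_mul _ hP]
  -- the elementary matrix `E_{ab}`, `a ≠ b`, commutes with every scalar but is not a scalar
  have hab : (⟨0, by omega⟩ : Fin N) ≠ ⟨1, by omega⟩ := by simp [Fin.ext_iff]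
  obtain ⟨c, hc⟩ := hirr (Matrix.single (⟨0, by omega⟩ : Fin N) (⟨1, by omega⟩ : Fin N) (1 : ℂ))
    (fun g => by
      obtain ⟨s, hs⟩ := hscal g
      simp only [hs, Matrix.mul_smul, Matrix.mul_one, Matrix.smul_mul, Matrix.one_mul])
  have h01 := congrFun (congrFun hc ⟨0, by omega⟩) ⟨1, by omega⟩
  rw [Matrix.single_apply_same, Matrix.smul_apply, Matrix.one_apply_ne hab, smul_zero] at h01
  exact one_ne_zero h01

/-- **A non-trivial continuous character confines in two dimensions.**  A continuous one-dimensional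
representation `ρ` (a character `χ`, automatically of modulus one) with some `ρ(g₀) ≠ 1` satisfies
`HasAreaLaw 2 ρ β` for every real `β`: its one-plaquette scalar `∫ χ e^{−β(1 − Re χ)}` is the REAL number
`∫ Re χ · e^{−β(1 − Re χ)}` (inversion symmetry of Haar, `χ(g⁻¹) = conj χ(g)`), and `Re χ(g₀) < 1`. -/
theorem hasAreaLaw_two_of_card_eq_one (ρ : G →* Matrix (Fin 1) (Fin 1) ℂ) (hρ : Continuous ρ)
    (hnt : ∃ g₀ : G, ρ g₀ ≠ 1) (β : ℝ) : HasAreaLaw 2 ρ β := by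
  have htr1 : ∀ A : Matrix (Fin 1) (Fin 1) ℂ, A.trace = A 0 0 := fun A => Matrix.trace_fin_one A
  -- `ρ(g⁻¹) = ρ(g)ᴴ` (the entry has modulus one)
  have hρu : ∀ u : G, (ρ u)ᴴ = ρ u⁻¹ := fun u => by
    ext i j
    have hi : i = 0 := Subsingleton.elim _ _
    have hj : j = 0 := Subsingleton.elim _ _
    subst hi hj
    have h := CompactGroup.trace_map_inv ρ hρ u
    rw [htr1, htr1] at h
    rw [Matrix.conjTranspose_apply, h, Complex.star_def]
  have hw : Continuous fun g : G => Real.exp (-(β * ((1 : ℕ) - (ρ g).trace.re))) := by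
    have := Complex.continuous_re.comp hρ.matrix_trace
    fun_prop
  have hwi : ∀ u : G, Real.exp (-(β * ((1 : ℕ) - (ρ u⁻¹).trace.re))) =
      Real.exp (-(β * ((1 : ℕ) - (ρ u).trace.re))) := fun u => by
    rw [CompactGroup.re_trace_map_inv ρ hρ]
  have hreal := integral_trace_mul_eq_ofReal ρ hρ hρu hw hwi
  refine hasAreaLaw_two_of_trace_re_lt ρ hρ β ?_ ?_
  · ext k l
    have hk : k = 0 := Subsingleton.elim _ _
    have hl : l = 0 := Subsingleton.elim _ _
    subst hk hl
    rw [Matrix.of_apply, Matrix.smul_apply, Matrix.one_apply_eq, smul_eq_mul, mul_one]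
    simp only [Nat.cast_one, inv_one, one_mul] at hreal ⊢
    rw [← hreal]
    refine integral_congr_ae (ae_of_all _ fun g => ?_)
    beta_reduce
    rw [htr1]
  · obtain ⟨g₀, hg₀⟩ := hnt
    refine ⟨g₀, ?_⟩
    by_contra hge
    push Not at hge
    rw [Nat.cast_one] at hge
    have hnorm : ‖(ρ g₀).trace‖ ≤ 1 := by simpa using norm_trace_le_card ρ hρ g₀
    have hre : (ρ g₀).trace.re ≤ ‖(ρ g₀).trace‖ := Complex.re_le_norm _
    have hsq : ‖(ρ g₀).trace‖ ^ 2 = (ρ g₀).trace.re ^ 2 + (ρ g₀).trace.im ^ 2 := by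
      rw [← Complex.normSq_eq_norm_sq, Complex.normSq_apply]; ring
    have him : (ρ g₀).trace.im = 0 := by nlinarith [sq_nonneg (ρ g₀).trace.im]
    have hone : (ρ g₀).trace = 1 := Complex.ext (by simp; linarith) (by simpa using him)
    apply hg₀
    ext i j
    have hi : i = 0 := Subsingleton.elim _ _
    have hj : j = 0 := Subsingleton.elim _ _
    subst hi hj
    rw [htr1] at hone
    rw [hone, Matrix.one_apply_eq]

omit [TopologicalSpace G] [IsTopologicalGroup G] [CompactSpace G] [SecondCountableTopology G]
  [MeasurableSpace G] [BorelSpace G] in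
/-- **Schur's lemma, matrix form.**  If the representation `v ↦ ρ(g) v` of `G` on `ℂ^N` is irreducible in
Mathlib's sense (`Representation.IsIrreducible`: no invariant subspace other than `0` and `ℂ^N`), then the
commutant of `ρ` is trivial (`IsIrreducibleFamily ρ`): a matrix commuting with every `ρ(g)` is an intertwining
map, hence a scalar (`Representation.IsIrreducible.algebraMap_intertwiningMap_bijective_of_isAlgClosed`). -/
theorem isIrreducibleFamily_of_isIrreducible
    (h : Representation.IsIrreducible
      ((Matrix.toLinAlgEquiv' : Matrix (Fin N) (Fin N) ℂ ≃ₐ[ℂ] ((Fin N → ℂ) →ₗ[ℂ] (Fin N → ℂ)))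
        |>.toRingEquiv.toMulEquiv.toMonoidHom.comp ρ)) :
    IsIrreducibleFamily fun g : G => ρ g := by
  set σ : Representation ℂ G (Fin N → ℂ) :=
    ((Matrix.toLinAlgEquiv' : Matrix (Fin N) (Fin N) ℂ ≃ₐ[ℂ] ((Fin N → ℂ) →ₗ[ℂ] (Fin N → ℂ)))
      |>.toRingEquiv.toMulEquiv.toMonoidHom.comp ρ) with hσ
  haveI : σ.IsIrreducible := h
  intro X hX
  have happ : ∀ (g : G) (v : Fin N → ℂ), σ g v = ρ g *ᵥ v := fun g v => rfl
  let F : σ.IntertwiningMap σ :=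
    LinearMap.intertwiningMap_of_isIntertwiningMap (ρ := σ) (σ := σ) (f := Matrix.toLin' X)
      (fun g v => by rw [happ, happ, Matrix.toLin'_apply, Matrix.toLin'_apply, Matrix.mulVec_mulVec,
        Matrix.mulVec_mulVec, hX g])
  obtain ⟨c, hc⟩ :=
    (Representation.IsIrreducible.algebraMap_intertwiningMap_bijective_of_isAlgClosed (ρ := σ)).2 F
  refine ⟨c, ?_⟩
  have hv : ∀ v : Fin N → ℂ, X *ᵥ v = c • v := fun v => by
    have h1 := congrArg (fun T : σ.IntertwiningMap σ => T v) hc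
    have hFv : F v = X *ᵥ v := rfl
    simp only [Representation.IntertwiningMap.algebraMap_apply, Representation.IntertwiningMap.coe_smul,
      Pi.smul_apply, Representation.IntertwiningMap.coe_one, hFv] at h1
    exact h1.symm
  apply Matrix.toLin'.injective
  refine LinearMap.ext fun v => ?_
  simp only [Matrix.toLin'_apply, hv, Matrix.smul_mulVec, Matrix.one_mulVec]

/-- **EVERY NON-TRIVIAL IRREDUCIBLE REPRESENTATION OF EVERY COMPACT GROUP CONFINES IN TWO DIMENSIONS AT EVERY
COUPLING.**  For a compact second-countable `G`, a continuous `ρ : G → M_N(ℂ)` (`N ≥ 1`) with trivial commutant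
(`IsIrreducibleFamily ρ`: only the scalars commute with every `ρ(g)` — every irreducible representation, by Schur's
lemma) which is not the trivial representation, and every real `β`: the two-dimensional lattice `G`-gauge theory
in the representation `ρ` satisfies the volume-uniform area law `HasAreaLaw 2 ρ β` — constants `C` and `c > 0`
(depending on `G, ρ, β` only) with `|⟨W_{R×T}⟩_{(ℤ/L)², β}| ≤ C^{2(R+T)} e^{−c RT}` for all torus sizes `L`, both
planes, all base points and all `1 ≤ R, T ≤ L/2`. -/
theorem hasAreaLaw_two_of_irreducible [NeZero N] (hρ : Continuous ρ)
    (hirr : IsIrreducibleFamily fun g : G => ρ g) (hnt : ∃ g₀ : G, ρ g₀ ≠ 1) (β : ℝ) :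
    HasAreaLaw 2 ρ β := by
  obtain hN1 | hN2 : N = 1 ∨ 2 ≤ N := by have := NeZero.pos N; omega
  · subst hN1
    exact hasAreaLaw_two_of_card_eq_one ρ hρ hnt β
  · exact hasAreaLaw_two_of_isIrreducibleFamily ρ hρ hirr
      (exists_norm_trace_lt_of_isIrreducibleFamily ρ hN2 hρ hirr) β

omit [SecondCountableTopology G] in
/-- **No area law for the trivial representation** (any dimension `d ≥ 2`, any coupling): if `ρ(g) = 1` for
all `g` then every Wilson loop observable is the constant `1`, so `⟨W_{R×T}⟩ = 1`, which no bound
`C^{2(R+T)} e^{−cRT}`, `c > 0`, dominates along the squares `R = T = n`, `L = 2n`. -/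
theorem not_hasAreaLaw_of_forall_eq_one {d : ℕ} [NeZero N] (hd : 2 ≤ d) (hρ1 : ∀ g : G, ρ g = 1) (β : ℝ) :
    ¬ HasAreaLaw d ρ β := by
  rintro ⟨C, c, hc, h⟩
  have hρ : Continuous ρ := by
    have h1 : (ρ : G → Matrix (Fin N) (Fin N) ℂ) = fun _ => 1 := funext hρ1
    rw [h1]
    exact continuous_const
  have hN : (N : ℝ) ≠ 0 := Nat.cast_ne_zero.mpr (NeZero.ne N)
  have hW : ∀ (L : ℕ) (x : Site d L) (i j : Fin d) (R T : ℕ),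
      wilsonLoop ρ x i j R T = fun _ : GaugeConfig d L G => (1 : ℝ) := by
    intro L x i j R T
    funext U
    unfold wilsonLoop
    rw [hρ1, Matrix.trace_one, Fintype.card_fin, Complex.natCast_re, inv_mul_cancel₀ hN]
  have hE : ∀ (L : ℕ) [NeZero L] (x : Site d L) (i j : Fin d) (R T : ℕ),
      wilsonExpectation ρ β (wilsonLoop ρ x i j R T) = 1 := by
    intro L _ x i j R T
    haveI := isProbabilityMeasure_wilsonMeasure (d := d) (L := L) ρ hρ β
    rw [hW]
    simp [wilsonExpectation]
  -- the square loops `n × n` in the torus of side `2n`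
  obtain ⟨n, hn⟩ : ∃ n : ℕ, 4 * |C| / c < n := exists_nat_gt _
  have hn1 : 1 ≤ n := by
    rcases Nat.eq_zero_or_pos n with h0 | h0
    · subst h0
      have : 0 ≤ 4 * |C| / c := by positivity
      simp at hn
      linarith
    · exact h0
  haveI : NeZero (2 * n) := ⟨by omega⟩
  have key := h (2 * n) (fun _ => 0) ⟨0, by omega⟩ ⟨1, by omega⟩ n n (by simp [Fin.ext_iff]) hn1 hn1 le_rfl le_rfl
  rw [hE, abs_one] at key
  -- `C^{4n} e^{−c n²} < 1`
  have hCle : C ^ (2 * (n + n)) ≤ Real.exp (|C|) ^ (4 * n) := by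
    rw [show 2 * (n + n) = 2 * (2 * n) by ring, pow_mul, ← sq_abs, ← pow_mul, show 2 * (2 * n) = 4 * n by ring]
    exact pow_le_pow_left₀ (abs_nonneg C) (by linarith [Real.add_one_le_exp |C|, abs_nonneg C]) _
  have hexp : Real.exp (|C|) ^ (4 * n) * Real.exp (-c * ((n : ℝ) * n)) =
      Real.exp ((n : ℝ) * (4 * |C| - c * n)) := by
    rw [← Real.exp_nat_mul, ← Real.exp_add]
    congr 1
    push_cast
    ring
  have hneg : (n : ℝ) * (4 * |C| - c * n) < 0 := by
    have hn0 : (0 : ℝ) < n := by exact_mod_cast hn1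
    have : 4 * |C| < c * n := by rw [div_lt_iff₀ hc] at hn; linarith
    exact mul_neg_of_pos_of_neg hn0 (by linarith)
  have hlt : C ^ (2 * (n + n)) * Real.exp (-c * ((n : ℝ) * n)) < 1 := by
    calc C ^ (2 * (n + n)) * Real.exp (-c * ((n : ℝ) * n))
        ≤ Real.exp (|C|) ^ (4 * n) * Real.exp (-c * ((n : ℝ) * n)) :=
          mul_le_mul_of_nonneg_right hCle (Real.exp_pos _).le
      _ = Real.exp ((n : ℝ) * (4 * |C| - c * n)) := hexp
      _ < 1 := Real.exp_lt_one_iff.mpr hneg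
  linarith

/-- The same with Mathlib's irreducibility of the representation `v ↦ ρ(g) v` on `ℂ^N`
(`Representation.IsIrreducible`) in place of the trivial-commutant property. -/
theorem hasAreaLaw_two_of_isIrreducible [NeZero N] (hρ : Continuous ρ)
    (h : Representation.IsIrreducible
      ((Matrix.toLinAlgEquiv' : Matrix (Fin N) (Fin N) ℂ ≃ₐ[ℂ] ((Fin N → ℂ) →ₗ[ℂ] (Fin N → ℂ)))
        |>.toRingEquiv.toMulEquiv.toMonoidHom.comp ρ))
    (hnt : ∃ g₀ : G, ρ g₀ ≠ 1) (β : ℝ) : HasAreaLaw 2 ρ β :=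
  hasAreaLaw_two_of_irreducible ρ hρ (isIrreducibleFamily_of_isIrreducible ρ h) hnt β

/-- **THE AREA LAW CHARACTERISES NON-TRIVIALITY.**  For a continuous representation with trivial commutant of a
compact second-countable group and any real `β`: `HasAreaLaw 2 ρ β` holds IF AND ONLY IF `ρ` is not the trivial
representation. -/
theorem hasAreaLaw_two_iff_of_irreducible [NeZero N] (hρ : Continuous ρ)
    (hirr : IsIrreducibleFamily fun g : G => ρ g) (β : ℝ) :
    HasAreaLaw 2 ρ β ↔ ∃ g₀ : G, ρ g₀ ≠ 1 := by
  refine ⟨fun h => ?_, fun hnt => hasAreaLaw_two_of_irreducible ρ hρ hirr hnt β⟩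
  by_contra hall
  push Not at hall
  exact not_hasAreaLaw_of_forall_eq_one ρ le_rfl hall β h

end General

/-! ## `SU(N)` confines in two dimensions iff `N ≥ 2` -/

section SpecialUnitaryIff

/-- `SU(1)` is the trivial group: its Wilson loop is identically `1`, so `HasAreaLaw 2 (fundamentalRep (Fin 1)) β`
FAILS for every `β`. -/
theorem not_hasAreaLaw_two_specialUnitary_one (β : ℝ) : ¬ HasAreaLaw 2 (fundamentalRep (Fin 1)) β :=
  not_hasAreaLaw_of_forall_eq_one (fundamentalRep (Fin 1)) le_rfl (fun g => by
    rw [fundamentalRep_apply]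
    ext i j
    have hi : i = 0 := Subsingleton.elim _ _
    have hj : j = 0 := Subsingleton.elim _ _
    subst hi hj
    have hdet := (Matrix.mem_specialUnitaryGroup_iff.mp g.2).2
    rw [Matrix.det_fin_one] at hdet
    rw [Matrix.one_apply_eq]
    exact hdet) β

/-- **TWO-DIMENSIONAL `SU(N)` LATTICE YANG–MILLS SATISFIES THE VOLUME-UNIFORM AREA LAW IF AND ONLY IF `N ≥ 2`**
(for every `N ≥ 1` and every real `β`). -/
theorem hasAreaLaw_two_specialUnitary_iff (N : ℕ) [NeZero N] (β : ℝ) :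
    HasAreaLaw 2 (fundamentalRep (Fin N)) β ↔ 2 ≤ N := by
  refine ⟨fun h => ?_, fun hN => hasAreaLaw_two_specialUnitary N hN β⟩
  by_contra hN
  have h1 : N = 1 := by have := NeZero.pos N; omega
  subst h1
  exact not_hasAreaLaw_two_specialUnitary_one β h

end SpecialUnitaryIff

/-! ## Infinite-volume limit points -/

section InfiniteVolume

variable {G : Type*} [Group G] [TopologicalSpace G] [IsTopologicalGroup G]
  [CompactSpace G] [T2Space G] [SecondCountableTopology G] [MeasurableSpace G] [BorelSpace G] {N : ℕ}
  (ρ : G →* Matrix (Fin N) (Fin N) ℂ)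

/-- **EVERY INFINITE-VOLUME LIMIT POINT OF THE TWO-DIMENSIONAL THEORY OBEYS THE AREA LAW** (state form
`HasAreaLawState` of `Literature…WilsonLoops`, S12): for every non-trivial continuous representation `ρ` with
trivial commutant of a compact metrisable group, every real `β` and every `μ ∈ infiniteVolumeLimitPoints ρ β`,
`|W_μ(R,T)| ≤ C^{2(R+T)} e^{−cRT}` with `c > 0` — the volume-uniform torus law `hasAreaLaw_two_of_irreducible`
passed to the limit by the tree's `hasAreaLawState_of_hasAreaLaw_holds`. -/
theorem hasAreaLawState_of_irreducible_two [NeZero N] (hρ : Continuous ρ)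
    (hirr : IsIrreducibleFamily fun g : G => ρ g) (hnt : ∃ g₀ : G, ρ g₀ ≠ 1) {β : ℝ}
    {μ : Measure (LGConfig 2 G)} (hμ : μ ∈ infiniteVolumeLimitPoints ρ β) :
    HasAreaLawState μ (fun g => normalisedCharacter N (ρ g)) :=
  hasAreaLawState_of_hasAreaLaw_holds ρ le_rfl hρ (hasAreaLaw_two_of_irreducible ρ hρ hirr hnt β) hμ

/-- `U(N)`, every `N ≥ 1`, every real `β`: every infinite-volume limit point obeys the area law (state form). -/
theorem hasAreaLawState_unitary_two (N : ℕ) [NeZero N] {β : ℝ}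
    {μ : Measure (LGConfig 2 (Matrix.unitaryGroup (Fin N) ℂ))}
    (hμ : μ ∈ infiniteVolumeLimitPoints (unitaryFundamentalRep (Fin N) ℂ) β) :
    HasAreaLawState μ (fun g => normalisedCharacter N (unitaryFundamentalRep (Fin N) ℂ g)) :=
  hasAreaLawState_of_hasAreaLaw_holds (unitaryFundamentalRep (Fin N) ℂ) le_rfl
    (continuous_unitaryFundamentalRep (Fin N) ℂ) (hasAreaLaw_two_unitary N β) hμ

/-- `SU(N)`, `N ≥ 2`, every real `β`: every infinite-volume limit point obeys the area law (state form). -/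
theorem hasAreaLawState_specialUnitary_two (N : ℕ) (hN : 2 ≤ N) {β : ℝ}
    {μ : Measure (LGConfig 2 (Matrix.specialUnitaryGroup (Fin N) ℂ))}
    (hμ : μ ∈ infiniteVolumeLimitPoints (fundamentalRep (Fin N)) β) :
    HasAreaLawState μ (fun g => normalisedCharacter N (fundamentalRep (Fin N) g)) := by
  haveI : NeZero N := ⟨by omega⟩
  exact hasAreaLawState_of_hasAreaLaw_holds (fundamentalRep (Fin N)) le_rfl (continuous_fundamentalRep (Fin N))
    (hasAreaLaw_two_specialUnitary N hN β) hμ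

end InfiniteVolume

end Summit.Ventures.LatticeQCDFlow.Scoring
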